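import Summits.FinalStateConjecture.FinalStateConjecture.Theorems.StarvedNecksNeckGapDecayTwistField
import Summits.FinalStateConjecture.FinalStateConjecture.Theorems.NeckGapDecay.Negative.ExactSchwarzschildGapCertificate
import Summits.FinalStateConjecture.FinalStateConjecture.Theorems.StarvedNecksNeckGapDecayGlueDeviation
import Literature.Geometry.Lorentzian.BackgroundChartCalculus
import Literature.Geometry.Lorentzian.SpacetimeMetricInCoordsCalculus
import HarnessLib

/-!
# The twisted hole chart of exact Schwarzschild and its deviation (crux `StarvedNecks.NeckGapDecay`,
# stmt-FinalStateConjecture-16768, line `Sketch`; model check of the physics stub's hypothesis)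

On the exact Schwarzschild model `ST P` of the crux disprover (`SeamedChartsExhaust.Negative.SchwModel`,
`NeckGapDecay.Negative.SchwGap`) the identity hole chart `Ψ` is replaced by the TWISTED chart
`Ψ_T = Ψ ∘ K`, `K x = R_{β(x)} x` the twist by the angle field `β = angle cTw (R₀ + 2)` of
`…TwistField` (`cTw = 1/(200 (C_S + 1))`).  This file proves:

* `Ψ_T` is smooth and a late-time chart with the SAME images of all time/radius-defined coordinate sets as
  `Ψ` (the twist is a homeomorphism of the domain preserving `t` and `r`);
* **the deviation formula** `(Ψ_T^* g − g_B)(x)(v, w) = a(v) η(Jx, w) + a(w) η(v, Jx) + a(v) a(w) η(Jx, Jx)`,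
  `a = dβ(x)` (axial symmetry of Schwarzschild + `ℓ(Jx) = 0`), hence the `C⁰` HONESTY bound
  `‖(Ψ_T^* g − g_B)(x)‖ ≤ 1/10` everywhere (lever-arm bound `‖dβ‖ s ≤ 6 cTw C_S ≤ 3/100`);
* the deviation VANISHES IDENTICALLY, with all derivatives, on the inner region `{‖x⃗‖ < λ(x⁰)}` (there
  `Ψ_T = Ψ` as germs);
* **the lower bound**: on every late slab `{t = τ}` there is a point of the shell, at radius `≤ 3/2 λ(τ)`,
  where `‖(Ψ_T^* g − g_B)‖ ≥ cTw` (mean value theorem along the radial test line).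

References: O'Neill 1995, Ch. 2, §2.2; Kerr–Schild 1965, §2; DHRT arXiv:2104.08222, §1; O'Neill 1983, Ch. 3.
-/

noncomputable section

open Set Function Filter Topology TopologicalSpace Manifold
open scoped Topology ContDiff Manifold ENNReal

namespace Summit.FinalStateConjecture.FinalStateConjecture.Theorems.NeckGapDecay.ConnectionLevelCones.Twist

open Literature.Geometry.Lorentzian
open Summit.FinalStateConjecture.FinalStateConjecture.Theorems.SeamedChartsExhaust.Negative
open Summit.FinalStateConjecture.FinalStateConjecture.Theorems.SeamedChartsExhaust.Negative.SchwModel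
open Summit.FinalStateConjecture.FinalStateConjecture.Theorems.NeckGapDecay.Negative (SchwGap.isLateChart_Ψ_at)
open Summit.FinalStateConjecture.FinalStateConjecture.Theorems.NeckGapDecay.ConnectionLevelCones.Glue
  (deviationExtend_eventuallyEq_of_eventuallyEq)

-- the problem namespace `Summit.FinalStateConjecture.FinalStateConjecture` repeats the summit name by design
set_option linter.dupNamespace false
-- instance search through nested operator types `E4 →L E4 →L E4 →L ℝ` (as in the tree files)
set_option maxSynthPendingDepth 3

variable (P : Params)

/-! ## The twist constants and the angle field of the model -/

/-- The twist amplitude `cTw = 1/(200 (C_S + 1))`. [folklore] -/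
def cTw : ℝ := 1 / (200 * (C_S + 1))

/-- `cTw > 0`. [folklore] -/
theorem cTw_pos : 0 < cTw := by unfold cTw; have := C_S_nonneg; positivity

/-- The honesty budget: `6 cTw C_S ≤ 3/100`. [folklore] -/
theorem six_cTw_C_S_le : 6 * cTw * C_S ≤ 3 / 100 := by
  have h0 := C_S_nonneg
  unfold cTw
  rw [show 6 * (1 / (200 * (C_S + 1))) * C_S = (3 / 100) * (C_S / (C_S + 1)) by field_simp; ring]
  have : C_S / (C_S + 1) ≤ 1 := by rw [div_le_one (by linarith)]; linarith
  nlinarith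

/-- The base radius `b = R₀ + 2` of the twist shell profile. [folklore] -/
def bP : ℝ := P.R₀ + 2

/-- `b ≥ 1`. [folklore] -/
theorem one_le_bP : 1 ≤ bP P := by have := P.R₀_pos; unfold bP; linarith

/-- `b > 0`. [folklore] -/
theorem bP_pos : 0 < bP P := by linarith [one_le_bP P]

/-- The model's angle field `β = cTw · S(‖x⃗‖²/λ(x⁰)²)`, `λ = R₀ + 2 + ¼ log(1 + t²)`. [folklore] -/
def ang : E4 → ℝ := angle cTw (bP P)

/-- The lever-arm bound of the model's angle field: `‖dβ(x)‖ ‖x⃗‖ ≤ 3/100`. [folklore] -/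
theorem norm_fderiv_ang_mul_le (x : E4) : ‖fderiv ℝ (ang P) x‖ * E4.spatialNorm x ≤ 3 / 100 := by
  have h := norm_fderiv_angle_mul_le cTw (one_le_bP P) x
  rw [abs_of_pos cTw_pos] at h
  exact h.trans six_cTw_C_S_le

/-! ## The twisted chart -/

/-- The hole background of the model (boosted Kerr with trivial motion, `a = 0`). [folklore] -/
abbrev Bh : ModelBackground := boostedKerrBackground 1 0 P.M 0

/-- Membership in the hole domain is decided by the Kerr–Schild radius, which the twist preserves. [folklore] -/
theorem twist_mem_iff (β : E4 → ℝ) (x : E4) : twist β x ∈ ((Bh P).domain : Set E4) ↔ x ∈ ((Bh P).domain : Set E4) := by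
  show twist β x ∈ boostedKerrExterior 1 0 P.M 0 ↔ x ∈ boostedKerrExterior 1 0 P.M 0
  rw [mem_bext_iff, mem_bext_iff, radius_twist]

/-- **The twisted hole chart** `Ψ_T x = Ψ (K x)`, `K = twist (ang P)`. [folklore] -/
def ΨT (x : (Bh P).domain) : (ST P).carrier := Ψ P ⟨twist (ang P) x.1, (twist_mem_iff P _ _).mpr x.2⟩

/-- Coordinates of the twisted chart: `(Ψ_T x).1 = K x`. [folklore] -/
@[simp] theorem ΨT_val (x : (Bh P).domain) : (ΨT P x).1 = twist (ang P) x.1 := rfl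

/-- The twist of the domain, as a homeomorphism of the domain. [folklore] -/
def KT : (Bh P).domain ≃ₜ (Bh P).domain :=
  (twistHomeomorph (isAxial_angle cTw (bP P)) (continuous_angle cTw (bP_pos P))).subtype
    fun x ↦ (twist_mem_iff P (ang P) x).symm

/-- `(KT x).1 = K x`. [folklore] -/
@[simp] theorem KT_val (x : (Bh P).domain) : (KT P x).1 = twist (ang P) x.1 := rfl

/-- `Ψ_T = Ψ ∘ KT`. [folklore] -/
theorem ΨT_eq_comp : ΨT P = Ψ P ∘ KT P := rfl

/-- The twist preserves the hole time. [folklore] -/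
@[simp] theorem time_KT (x : (Bh P).domain) : (Bh P).time (KT P x).1 = (Bh P).time x.1 := by
  rw [KT_val, bg_time, bg_time, twist_apply_zero]

/-- The twist preserves the hole radius. [folklore] -/
@[simp] theorem radius_KT (x : (Bh P).domain) : (Bh P).radius (KT P x).1 = (Bh P).radius x.1 := by
  rw [KT_val, bg_radius, bg_radius, radius_twist]

/-- **Invariant coordinate sets have the same image under `Ψ_T` and `Ψ`**: if membership in `A` depends
only on data preserved by the twist (in both directions), then `Ψ_T '' A = Ψ '' A`. [folklore] -/
theorem image_ΨT_eq {A : Set (Bh P).domain} (hA : ∀ x, x ∈ A ↔ KT P x ∈ A) : ΨT P '' A = Ψ P '' A := by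
  rw [ΨT_eq_comp, image_comp]
  congr 1
  refine Subset.antisymm ?_ ?_
  · rintro _ ⟨x, hx, rfl⟩; exact (hA x).mp hx
  · intro x hx
    refine ⟨(KT P).symm x, ?_, (KT P).apply_symm_apply x⟩
    rw [hA, (KT P).apply_symm_apply]; exact hx

/-- Sets cut out by the hole time and radius are twist-invariant. [folklore] -/
theorem mem_iff_KT_mem {p : ℝ → ℝ → Prop} (x : (Bh P).domain) :
    x ∈ {y : (Bh P).domain | p ((Bh P).time y.1) ((Bh P).radius y.1)} ↔
      KT P x ∈ {y : (Bh P).domain | p ((Bh P).time y.1) ((Bh P).radius y.1)} := by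
  simp only [mem_setOf_eq, time_KT, radius_KT]

/-- The twist (as a map of `E4`) is smooth. [folklore] -/
theorem contDiff_twist_ang : ContDiff ℝ ∞ (twist (ang P)) := contDiff_twist (contDiff_angle cTw (bP_pos P))

/-- **The twisted chart is smooth.** [folklore] -/
theorem contMDiff_ΨT : ContMDiff 𝓘(ℝ, E4) (𝓡 4) ∞ (ΨT P) := by
  intro x
  have hΨ : ContMDiff 𝓘(ℝ, E4) (𝓡 4) ∞ (Ψ P) := (isLateChart_Ψ P).contMDiff
  have hpar : ContMDiffOn 𝓘(ℝ, E4) (𝓡 4) ∞ (Ψ P ∘ (chartAt E4 x).symm) ((Bh P).domain : Set E4) :=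
    (ST P).contMDiffOn_comp_chartAt_symm (Bh P) (Ψ P) x hΨ
  have hK : ContMDiff 𝓘(ℝ, E4) 𝓘(ℝ, E4) ∞ (fun y : (Bh P).domain ↦ twist (ang P) y.1) :=
    (contDiff_twist_ang P).contMDiff.comp contMDiff_subtype_val
  have hcomp := hpar.comp_contMDiff hK fun y ↦ (twist_mem_iff P _ _).mpr y.2
  have heq : (Ψ P ∘ (chartAt E4 x).symm) ∘ (fun y : (Bh P).domain ↦ twist (ang P) y.1) = ΨT P := by
    funext y
    show Ψ P ((chartAt E4 x).symm (twist (ang P) y.1)) = Ψ P _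
    congr 1
    exact Subtype.ext (OpensChart.chartAt_symm_val x ((twist_mem_iff P _ _).mpr y.2))
  rw [← heq]
  exact hcomp x

/-- **The twisted chart is a late-time chart into `O`** after any chart time `τ₀`: smooth; on the late region an
open embedding (`Ψ` is, and `KT` restricts to a homeomorphism of the late region); hole-late points in `O`
(same image as `Ψ`). [folklore] -/
theorem isLateChart_ΨT (τ₀ : ℝ) : (ST P).IsLateChart (Bh P) (O P) τ₀ (ΨT P) := by
  have hΨ := SchwGap.isLateChart_Ψ_at P τ₀
  refine ⟨contMDiff_ΨT P, ?_, ?_⟩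
  · have hiff : ∀ x : (Bh P).domain, x ∈ (Bh P).lateRegion τ₀ ↔ KT P x ∈ (Bh P).lateRegion τ₀ := fun x ↦ by
      show τ₀ < (Bh P).time x.1 ↔ τ₀ < (Bh P).time (KT P x).1
      rw [time_KT]
    let e : (Bh P).lateRegion τ₀ ≃ₜ (Bh P).lateRegion τ₀ := (KT P).subtype hiff
    have hcomp : ((Bh P).lateRegion τ₀).restrict (ΨT P) = ((Bh P).lateRegion τ₀).restrict (Ψ P) ∘ e := by
      funext x; rfl
    rw [hcomp]
    exact hΨ.isOpenEmbedding.comp e.isOpenEmbedding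
  · rintro _ ⟨x, hx, rfl⟩
    refine hΨ.image_subset ⟨KT P x, ?_, rfl⟩
    show τ₀ < (Bh P).time (KT P x).1
    rw [time_KT]; exact hx

/-! ## The deviation of the twisted chart -/

/-- The twist is differentiable with differential `twistDeriv`. [folklore] -/
theorem hasFDerivAt_twist_ang (x : E4) :
    HasFDerivAt (twist (ang P)) (twistDeriv (ang P) (fderiv ℝ (ang P) x) x) x :=
  hasFDerivAt_twist ((contDiff_angle cTw (bP_pos P) (n := 1)).differentiable (by simp) x).hasFDerivAt

/-- **THE DEVIATION FORMULA of the twisted chart**: with `a = dβ(x)` and `J` the rotation generator,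
`(Ψ_T^* g − g_B)(x)(v, w) = a(v) η(Jx, w) + a(w) η(v, Jx) + a(v) a(w) η(Jx, Jx)`.
(Chain rule for the components, `Ψ^* g = g_B` exactly, axial symmetry of Schwarzschild, `ℓ(Jx) = 0`.) [folklore] -/
theorem deviation_ΨT_apply (x : (Bh P).domain) (v w : E4) :
    (ST P).deviation (Bh P) (ΨT P) x v w =
      fderiv ℝ (ang P) x.1 v * Minkowski.bilin (E4.axialGenerator x.1) w +
        fderiv ℝ (ang P) x.1 w * Minkowski.bilin v (E4.axialGenerator x.1) +
        fderiv ℝ (ang P) x.1 v * fderiv ℝ (ang P) x.1 w *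
          Minkowski.bilin (E4.axialGenerator x.1) (E4.axialGenerator x.1) := by
  have hΨ : ContMDiff 𝓘(ℝ, E4) (𝓡 4) ∞ (Ψ P) := (isLateChart_Ψ P).contMDiff
  have hx : x.1 ∈ ((Bh P).domain : Set E4) := x.2
  have hKx : twist (ang P) x.1 ∈ ((Bh P).domain : Set E4) := (twist_mem_iff P _ _).mpr hx
  -- the germ of the parametrisation of `Ψ_T` is the parametrisation of `Ψ` precomposed with the twist
  have hev : (ΨT P ∘ (chartAt E4 x).symm) =ᶠ[𝓝 x.1] ((Ψ P ∘ (chartAt E4 x).symm) ∘ twist (ang P)) := by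
    filter_upwards [(Bh P).domain.2.mem_nhds hx] with z hz
    have hKz : twist (ang P) z ∈ ((Bh P).domain : Set E4) := (twist_mem_iff P _ _).mpr hz
    have e1 : (chartAt E4 x).symm z = ⟨z, hz⟩ := Subtype.ext (OpensChart.chartAt_symm_val x hz)
    have e2 : (chartAt E4 x).symm (twist (ang P) z) = ⟨twist (ang P) z, hKz⟩ :=
      Subtype.ext (OpensChart.chartAt_symm_val x hKz)
    show ΨT P ((chartAt E4 x).symm z) = Ψ P ((chartAt E4 x).symm (twist (ang P) z))
    rw [e1, e2]; rfl
  have hψ : MDifferentiableAt 𝓘(ℝ, E4) (𝓡 4) (Ψ P ∘ (chartAt E4 x).symm) (twist (ang P) x.1) :=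
    (ST P).mdifferentiableAt_comp_chartAt_symm (Bh P) (Ψ P) x hKx ((hΨ _).mdifferentiableAt (by simp))
  have hθ := hasFDerivAt_twist_ang P x.1
  have h1 := (ST P).metricInCoords_eq_bilinPullback_of_eventuallyEq hev hψ hθ.differentiableAt
  -- components of `Ψ_T` minus the background = its deviation
  have hmd : MDifferentiableAt 𝓘(ℝ, E4) (𝓡 4) (ΨT P) ⟨x.1, hx⟩ := (contMDiff_ΨT P _).mdifferentiableAt (by simp)
  have h2 := (ST P).metricInCoords_comp_chartAt_symm_sub_eq_deviation (Bh P) (ΨT P) x hx hmd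
  -- components of `Ψ` = background (the identity chart has zero deviation)
  have h3 : (ST P).metricInCoords (Ψ P ∘ (chartAt E4 x).symm) (twist (ang P) x.1) = (Bh P).bilin (twist (ang P) x.1) := by
    rw [(ST P).metricInCoords_comp_chartAt_symm_eq_deviation_add (Bh P) (Ψ P) x hKx
      ((hΨ _).mdifferentiableAt (by simp)), deviation_Ψ, zero_add]
  have h4 : (ST P).deviation (Bh P) (ΨT P) x v w =
      (Bh P).bilin (twist (ang P) x.1) (twistDeriv (ang P) (fderiv ℝ (ang P) x.1) x.1 v)
        (twistDeriv (ang P) (fderiv ℝ (ang P) x.1) x.1 w) - (Bh P).bilin x.1 v w := by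
    have h2' := congrArg (fun F : E4 →L[ℝ] E4 →L[ℝ] ℝ ↦ F v w) h2
    simp only [sub_apply] at h2'
    rw [show (⟨x.1, hx⟩ : (Bh P).domain) = x from rfl] at h2'
    rw [← h2', h1, bilinPullback_apply, h3, hθ.fderiv]
  rw [h4]
  show boostedKerrBilin 1 0 P.M 0 _ _ _ - boostedKerrBilin 1 0 P.M 0 _ _ _ = _
  rw [boostedKerrBilin_one_zero, boostedKerrBilin_one_zero, kerr_bilin_twist, kerr_bilin_add_smul_sub]

/-- **`C⁰` HONESTY of the twisted chart**: `‖(Ψ_T^* g − g_B)(x)‖ ≤ 1/10` at every point of the domain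
(`≤ 2κ + κ²`, `κ = ‖dβ‖ s ≤ 3/100`). [folklore] -/
theorem norm_deviation_ΨT_le (x : (Bh P).domain) : ‖(ST P).deviation (Bh P) (ΨT P) x‖ ≤ 1 / 10 := by
  set κ := ‖fderiv ℝ (ang P) x.1‖ * E4.spatialNorm x.1 with hκ
  have hκ0 : 0 ≤ κ := mul_nonneg (norm_nonneg _) (E4.spatialNorm_nonneg _)
  have hκ1 : κ ≤ 3 / 100 := norm_fderiv_ang_mul_le P x.1
  have hC : 2 * κ + κ ^ 2 ≤ 1 / 10 := by nlinarith
  refine (ContinuousLinearMap.opNorm_le_bound₂ _ (by positivity) fun v w ↦ ?_).trans hC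
  rw [deviation_ΨT_apply, Real.norm_eq_abs]
  have h := abs_twistForm_le (fderiv ℝ (ang P) x.1) x.1 v w
  calc _ ≤ (2 * κ + κ ^ 2) * (‖v‖ * ‖w‖) := h
    _ = (2 * κ + κ ^ 2) * ‖v‖ * ‖w‖ := by ring

/-- **The twisted chart IS the identity chart near inner points**: if `‖x⃗‖² < λ(x⁰)²` then `Ψ_T = Ψ` on a
neighbourhood of `x` (the angle vanishes on the open inner region). [folklore] -/
theorem ΨT_eventuallyEq_Ψ {x : (Bh P).domain} (hx : qsq x.1 < lam (bP P) (x.1 0) ^ 2) : ΨT P =ᶠ[𝓝 x] Ψ P := by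
  have ho : IsOpen {y : (Bh P).domain | qsq y.1 < lam (bP P) (y.1 0) ^ 2} :=
    (isOpen_inner (bP P)).preimage continuous_subtype_val
  filter_upwards [ho.mem_nhds hx] with y hy
  have hK : twist (ang P) y.1 = y.1 := twist_eq_self _ (angle_eq_zero cTw (bP_pos P) hy.le)
  show Ψ P _ = Ψ P y
  congr 1
  exact Subtype.ext hK

/-- On the inner region ALL derivatives of the extended deviation of the twisted chart vanish. [folklore] -/
theorem iteratedFDeriv_deviationExtend_ΨT_eq_zero {x : (Bh P).domain} (hx : qsq x.1 < lam (bP P) (x.1 0) ^ 2)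
    (m : ℕ) : iteratedFDeriv ℝ m ((ST P).deviationExtend (Bh P) (ΨT P)) x.1 = 0 := by
  have h1 := deviationExtend_eventuallyEq_of_eventuallyEq (ST P) (Bh P) (ΨT_eventuallyEq_Ψ P hx)
  rw [deviationExtend_Ψ] at h1
  rw [(h1.iteratedFDeriv ℝ m).eq_of_nhds]
  simp

/-! ## The lower bound on the shell -/

/-- **NON-CERTIFICATION WITNESS**: on every slab `{t = τ}` there is a point of the domain with hole time `τ`,
radius `≤ 3/2 · λ(τ)`, at which `‖(Ψ_T^* g − g_B)‖ ≥ cTw`.  Along the radial test line `u ↦ (τ, u, 0, 0)` the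
angle climbs from `0` at `u = λ(τ)` to `cTw` at `u = √2 λ(τ)`; at a mean-value point `u*` its radial derivative is
`D = cTw/((√2 − 1) λ) > 0`, and the deviation evaluated on `(e₁, e₂)` there is `D u* (1 + a(e₂) u*)` with
`|a(e₂)| u* ≤ 3/100`. [folklore] -/
theorem exists_norm_deviation_ΨT_ge (τ : ℝ) :
    ∃ x : (Bh P).domain, (Bh P).time x.1 = τ ∧ (Bh P).radius x.1 ≤ 3 / 2 * lam (bP P) τ ∧
      2 * P.M < (Bh P).radius x.1 ∧ cTw ≤ ‖(ST P).deviation (Bh P) (ΨT P) x‖ := by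
  set L := lam (bP P) τ with hL
  have hL2 : P.R₀ + 2 ≤ L := le_lam _ _
  have hM : 2 * P.M < P.R₀ := P.two_M_lt_R₀
  have hL0 : 0 < L := by linarith [P.two_M_pos]
  -- the angle along the test line
  set φ : ℝ → ℝ := fun u ↦ ang P (pt τ u) with hφ
  have hφ_eq : ∀ u, φ u = cTw * stepS (u ^ 2 / L ^ 2) := fun u ↦ angle_pt cTw (bP P) τ u
  have hφa : φ L = 0 := by
    rw [hφ_eq, stepS_of_le_one (by rw [div_le_one (by positivity)]), mul_zero]
  have hφb : φ (Real.sqrt 2 * L) = cTw := by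
    rw [hφ_eq, stepS_of_two_le, mul_one]
    rw [mul_pow, Real.sq_sqrt (by norm_num : (0 : ℝ) ≤ 2), le_div_iff₀ (by positivity)]
  have hab : L < Real.sqrt 2 * L := by
    have : (1 : ℝ) < Real.sqrt 2 := by
      rw [show (1 : ℝ) = Real.sqrt 1 from Real.sqrt_one.symm]
      exact Real.sqrt_lt_sqrt zero_le_one (by norm_num)
    nlinarith
  -- differentiability of `φ` with derivative `dβ(pt τ u)(e₁)`
  have hdiff : ∀ u, HasDerivAt φ (fderiv ℝ (ang P) (pt τ u) (E4.basisVector 1)) u := fun u ↦ by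
    have h1 : HasFDerivAt (ang P) (fderiv ℝ (ang P) (pt τ u)) (pt τ u) :=
      ((contDiff_angle cTw (bP_pos P) (n := 1)).differentiable (by simp) _).hasFDerivAt
    exact h1.comp_hasDerivAt u (hasDerivAt_pt τ u)
  obtain ⟨u, hu, hu'⟩ := exists_hasDerivAt_eq_slope φ (fun u ↦ fderiv ℝ (ang P) (pt τ u) (E4.basisVector 1))
    hab (fun u _ ↦ (hdiff u).continuousAt.continuousWithinAt) (fun u _ ↦ hdiff u)
  rw [hφa, hφb, sub_zero] at hu'
  obtain ⟨hu1, hu2⟩ := hu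
  have hu0 : 0 < u := hL0.trans hu1
  set D := fderiv ℝ (ang P) (pt τ u) (E4.basisVector 1) with hD
  -- `D (√2 L − L) = cTw`, so `D u ≥ D L ≥ cTw / (√2 − 1) ≥ 2 cTw`
  have hs2 : Real.sqrt 2 < 3 / 2 := by
    rw [show (3 / 2 : ℝ) = Real.sqrt (9 / 4) by rw [show (9 / 4 : ℝ) = (3 / 2) ^ 2 by norm_num, Real.sqrt_sq (by norm_num)]]
    exact Real.sqrt_lt_sqrt (by norm_num) (by norm_num)
  have h1 : D * (Real.sqrt 2 * L - L) = cTw := by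
    rw [hu', div_mul_cancel₀]; exact (sub_pos.mpr hab).ne'
  have hDpos : 0 < D := by nlinarith [cTw_pos, sub_pos.mpr hab]
  have hDu : 2 * cTw ≤ D * u := by
    have h2 : D * L ≤ D * u := mul_le_mul_of_nonneg_left hu1.le hDpos.le
    have h3 : cTw ≤ D * L / 2 := by nlinarith [mul_pos hDpos hL0]
    linarith
  -- the point
  have hmem : pt τ u ∈ ((Bh P).domain : Set E4) := by
    show pt τ u ∈ boostedKerrExterior 1 0 P.M 0
    rw [mem_bext_iff, Kerr.radius_zero_left, spatialNorm_pt, abs_of_pos hu0]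
    linarith
  refine ⟨⟨pt τ u, hmem⟩, ?_, ?_, ?_, ?_⟩
  · rw [bg_time]; rfl
  · show Kerr.radius 0 (poincareInv 1 0 (pt τ u)) ≤ 3 / 2 * L
    rw [poincareInv_one_zero, Kerr.radius_zero_left, spatialNorm_pt, abs_of_pos hu0]
    nlinarith
  · show 2 * P.M < Kerr.radius 0 (poincareInv 1 0 (pt τ u))
    rw [poincareInv_one_zero, Kerr.radius_zero_left, spatialNorm_pt, abs_of_pos hu0]
    linarith
  · -- evaluate the deviation on `(e₁, e₂)`
    set a₂ := fderiv ℝ (ang P) (pt τ u) (E4.basisVector 2) with ha₂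
    have hval : (ST P).deviation (Bh P) (ΨT P) ⟨pt τ u, hmem⟩ (E4.basisVector 1) (E4.basisVector 2) =
        D * u * (1 + a₂ * u) := by
      rw [deviation_ΨT_apply]
      simp only [axialGenerator_pt, map_smul, smul_eq_mul, smul_apply]
      have e3 : (2 : Fin 3).succ = (3 : Fin 4) := rfl
      simp [Minkowski.bilin_apply, Fin.sum_univ_three, e3, Fin.succ_zero_eq_one, Fin.succ_one_eq_two, ← hD, ← ha₂]
      ring
    -- `|a₂| u ≤ 3/100`
    have ha₂u : |a₂| * u ≤ 3 / 100 := by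
      have h1 := norm_fderiv_ang_mul_le P (pt τ u)
      rw [spatialNorm_pt, abs_of_pos hu0] at h1
      have h2 : |a₂| ≤ ‖fderiv ℝ (ang P) (pt τ u)‖ := by
        have := (fderiv ℝ (ang P) (pt τ u)).le_opNorm (E4.basisVector 2)
        rw [Real.norm_eq_abs] at this
        simpa using this
      nlinarith [abs_nonneg a₂]
    have hlow : cTw ≤ |D * u * (1 + a₂ * u)| := by
      rw [abs_mul, abs_of_pos (mul_pos hDpos hu0)]
      have h3 : 97 / 100 ≤ |1 + a₂ * u| := by
        have : |a₂ * u| ≤ 3 / 100 := by rw [abs_mul, abs_of_pos hu0]; exact ha₂u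
        have := abs_sub_abs_le_abs_sub 1 (-(a₂ * u))
        rw [abs_one, abs_neg, sub_neg_eq_add] at this
        linarith
      nlinarith [cTw_pos]
    calc cTw ≤ |D * u * (1 + a₂ * u)| := hlow
      _ = ‖(ST P).deviation (Bh P) (ΨT P) ⟨pt τ u, hmem⟩ (E4.basisVector 1) (E4.basisVector 2)‖ := by
          rw [hval, Real.norm_eq_abs]
      _ ≤ ‖(ST P).deviation (Bh P) (ΨT P) ⟨pt τ u, hmem⟩ (E4.basisVector 1)‖ * ‖(E4.basisVector 2 : E4)‖ :=
          ContinuousLinearMap.le_opNorm _ _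
      _ ≤ ‖(ST P).deviation (Bh P) (ΨT P) ⟨pt τ u, hmem⟩‖ * ‖(E4.basisVector 1 : E4)‖ * ‖(E4.basisVector 2 : E4)‖ :=
          mul_le_mul_of_nonneg_right (ContinuousLinearMap.le_opNorm _ _) (norm_nonneg _)
      _ = ‖(ST P).deviation (Bh P) (ΨT P) ⟨pt τ u, hmem⟩‖ := by simp

/-- **Summary of this file (registered helper)**: for every parameter set, the twisted hole chart is `C⁰`-honest
(`≤ 1/10`) everywhere AND on every slab carries deviation `≥ cTw` at a point of radius `≤ 3/2 λ(τ)`. [folklore] -/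
theorem twistedChart_honest_uncertified : ∀ P : Params, (∀ x : (Bh P).domain, ‖(ST P).deviation (Bh P) (ΨT P) x‖ ≤ 1 / 10) ∧ ∀ τ : ℝ, ∃ x : (Bh P).domain, (Bh P).time x.1 = τ ∧ (Bh P).radius x.1 ≤ 3 / 2 * lam (bP P) τ ∧ 2 * P.M < (Bh P).radius x.1 ∧ cTw ≤ ‖(ST P).deviation (Bh P) (ΨT P) x‖ :=
  fun P ↦ ⟨norm_deviation_ΨT_le P, exists_norm_deviation_ΨT_ge P⟩

end Summit.FinalStateConjecture.FinalStateConjecture.Theorems.NeckGapDecay.ConnectionLevelCones.Twist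

end
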